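import Literature.Topology.FourManifolds.TwoSidedFromLocalSides
import Literature.Topology.FourManifolds.LocallyFlatTwoSided
import Literature.Topology.FourManifolds.EmbeddedHalfSpaceParam
import Literature.Analysis.Calculus.ThickenedImmersionChart
import Literature.Analysis.Calculus.OddReflection
import Mathlib.Data.Real.Sign
import HarnessLib

/-!
# Local side indicators of a compressing disc in a handlebody (every point, one chart)

Topic `Literature/Topology/FourManifolds` (consumer-side work for the fact seat
`provefact-Literature.Topology.FourManifolds.Trisection.isConnectedSum_circleProd_of_reducing_nonseparating`).
**Everything here is proved; no new facts.**

Let `X` be a smooth `4`-manifold, `H ⊆ X` a "handlebody" and `F ⊆ H` its boundary surface, both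
read in a chart `Ξ` of the maximal atlas on an open `V` as the linear half-slice
`H = {Ξ⁰ = 0, Ξ¹ ≥ 0}`, `F = {Ξ⁰ = 0, Ξ¹ = 0}` (`EmbeddedHypersurfaceSliceChart.lean`), and let
`d : 𝔻² → X` be a smoothly embedded disc with `d(𝔻²) ⊆ H` meeting `F` exactly in `d(∂𝔻²)`
(a compressing disc, `Trisection.BoundsDisc`).  For EVERY `z₀ ∈ 𝔻²` with `d z₀ ∈ V` we build a
local side indicator (`IsLocalSide H (range d) W s`, `TwoSidedFromLocalSides.lean`) at `d z₀`:

* read `d` near `z₀` through `Ξ` (`exists_halfSpaceParam_of_isSmoothEmbedding`): a `C^∞` map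
  `E` on an open ball of `ℝ²` parametrising `d(𝔻²)` on the half ball `{u⁰ ≥ 0}`;
* reflect oddly across `{u⁰ = 0}` (`OddReflection.lean`): a `C¹` map `Ẽ` on the whole ball, equal
  to `E` on the half ball, with values in the slice `{ξ⁰ = 0}` and `Ẽ¹ < 0` on `{u⁰ < 0}` — the
  reflected half-disc leaves `H` (at interior points `u₀⁰ > 0` the ball lies in `{u⁰ > 0}` and
  nothing is reflected);
* thicken (`exists_thickeningChart`): `Θ((u, a), ν) = Ẽ u + a e₀ + ν n` is a local homeomorphism of
  `ℝ⁴` for a vector `n` with `n⁰ = 0`, `n¹ = 1` off the tangent plane; `s := sign ν ∘ Θ⁻¹ ∘ Ξ`;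
* in these coordinates `H = {a = 0, μ(u) + ν ≥ 0}` (`μ = Ẽ¹`, odd in `u⁰`), `d(𝔻²) = {a = ν = 0,
  u⁰ ≥ 0}`, and the two sides of a product neighbourhood are the preconnected regions of
  `ThickenedImmersionChart.lean` (`isPreconnected_upperSide_of_gt`, `isPreconnected_lowerSide`);
* at boundary points (`d z₀ ∈ F`) the same `s` is ALSO a local side indicator of the curve
  `δ = d(∂𝔻²)` inside the surface `F` (`F = {a = 0, ν = -μ u}`, its sides are graphs over the two
  half balls), and `t ↦ Ξ⁻¹ Θ((u₀ + t e₀, 0), -μ)` is an arc of `F` crossing `δ` once, on which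
  `s = -sign t` ("`F` crosses the disc along `δ`").

This is the local ("standard") picture behind "a compressing disc is two-sided and `∂H` crosses
it along its boundary" (Hirsch 1976, Ch. 4, Thm. 4.2/4.6; Hempel, *3-Manifolds*, Ch. 1), made
chart-explicit.

## References

* M. W. Hirsch, *Differential Topology*, GTM 33, Springer (1976), Ch. 1 §3–4, Ch. 4 §4–6.
  [HirschDT1976]
* J. M. Lee, *Introduction to Smooth Manifolds*, 2nd ed. (2013), Thm. 1.46, Thm. 5.8.
  [LeeSmoothManifolds2013]
-/

noncomputable section

open Set Function Filter Metric Manifold Module Literature.Analysis.Calculus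
open scoped Manifold ContDiff Topology

namespace Literature.Topology.FourManifolds

/-! ### Small helpers -/

/-- The sign of a continuous function is locally constant off its zero set. [folklore] -/
theorem eventually_realSign_comp_eq {α : Type*} [TopologicalSpace α] {f : α → ℝ} {x : α}
    (hf : ContinuousAt f x) (hx : f x ≠ 0) : ∀ᶠ z in 𝓝 x, Real.sign (f z) = Real.sign (f x) := by
  rcases lt_or_gt_of_ne hx with h | h
  · filter_upwards [hf.eventually (gt_mem_nhds h)] with z hz
    rw [Real.sign_of_neg hz, Real.sign_of_neg h]
  · filter_upwards [hf.eventually (lt_mem_nhds h)] with z hz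
    rw [Real.sign_of_pos hz, Real.sign_of_pos h]

/-- A neighbourhood of `((u, 0), 0)` in `(P × ℝ) × ℝ` contains a product box
`(ball u ρ × (-ρ, ρ)) × (-ρ, ρ)`. [folklore] -/
theorem exists_box_subset {P : Type*} [PseudoMetricSpace P] {u : P} {s : Set ((P × ℝ) × ℝ)}
    (hs : s ∈ 𝓝 ((u, (0 : ℝ)), (0 : ℝ))) :
    ∃ ρ > 0, (ball u ρ ×ˢ Ioo (-ρ) ρ) ×ˢ Ioo (-ρ) ρ ⊆ s := by
  obtain ⟨ρ, hρ, hball⟩ := Metric.mem_nhds_iff.1 hs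
  refine ⟨ρ, hρ, Subset.trans ?_ hball⟩
  have h1 : Ioo (-ρ) ρ = ball (0 : ℝ) ρ := by rw [Real.ball_eq_Ioo, zero_sub, zero_add]
  rw [h1, ball_prod_same, ball_prod_same]

/-- Boxes are monotone in the radius. [folklore] -/
theorem box_mono {P : Type*} [PseudoMetricSpace P] {u : P} {ρ ρ' ε ε' : ℝ} (h : ρ ≤ ρ')
    (h' : ε ≤ ε') :
    (ball u ρ ×ˢ Ioo (-ρ) ρ) ×ˢ Ioo (-ε) ε ⊆ (ball u ρ' ×ˢ Ioo (-ρ') ρ') ×ˢ Ioo (-ε') ε' :=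
  prod_mono (prod_mono (ball_subset_ball h) (Ioo_subset_Ioo (neg_le_neg h) h))
    (Ioo_subset_Ioo (neg_le_neg h') h')

/-- Boxes are open. [folklore] -/
theorem isOpen_box {P : Type*} [PseudoMetricSpace P] (u : P) (ρ ε : ℝ) :
    IsOpen ((ball u ρ ×ˢ Ioo (-ρ) ρ) ×ˢ Ioo (-ε) ε) :=
  (isOpen_ball.prod isOpen_Ioo).prod isOpen_Ioo

/-- **A vector off a `3`-dimensional range with two prescribed coordinates.**  For a linear map
`T` into `ℝ⁴` from a space of dimension `< 4` there is `n ∈ ℝ⁴` with `n 0 = 0`, `n 1 = 1` and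
`n ∉ range T` (the affine plane `{ξ⁰ = 0, ξ¹ = 1}` spans the hyperplane `{ξ⁰ = 0}`, which together
with `e₀` would give all of `ℝ⁴`). [folklore] -/
theorem exists_notMem_range_apply_eq {M : Type*} [AddCommGroup M] [Module ℝ M]
    [FiniteDimensional ℝ M] (hM : finrank ℝ M < 4)
    (T : M →ₗ[ℝ] EuclideanSpace ℝ (Fin 4)) (h0 : ∃ m, T m = EuclideanSpace.single 0 1) :
    ∃ n : EuclideanSpace ℝ (Fin 4), n 0 = 0 ∧ n 1 = 1 ∧ n ∉ LinearMap.range T := by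
  by_contra hcon'
  have hcon : ∀ n : EuclideanSpace ℝ (Fin 4), n 0 = 0 → n 1 = 1 → n ∈ LinearMap.range T :=
    fun n h0 h1 => by_contra fun h => hcon' ⟨n, h0, h1, h⟩
  -- every vector with `ξ 0 = 0` is in the range
  have hZ : ∀ w : EuclideanSpace ℝ (Fin 4), w 0 = 0 → w ∈ LinearMap.range T := by
    intro w hw
    have h1 : EuclideanSpace.single (1 : Fin 4) (1 : ℝ) ∈ LinearMap.range T :=
      hcon _ (by simp) (by simp)
    have h2 : w + (1 - w 1) • EuclideanSpace.single (1 : Fin 4) (1 : ℝ) ∈ LinearMap.range T :=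
      hcon _ (by simp [hw]) (by simp)
    have := Submodule.sub_mem _ h2 (Submodule.smul_mem _ (1 - w 1) h1)
    rwa [add_sub_cancel_right] at this
  -- hence everything is in the range
  have htop : LinearMap.range T = ⊤ := by
    rw [eq_top_iff]
    rintro ξ -
    obtain ⟨m, hm⟩ := h0
    have h1 : EuclideanSpace.single (0 : Fin 4) (1 : ℝ) ∈ LinearMap.range T := ⟨m, hm⟩
    have h2 : ξ - ξ 0 • EuclideanSpace.single (0 : Fin 4) (1 : ℝ) ∈ LinearMap.range T :=
      hZ _ (by simp)
    have := Submodule.add_mem _ h2 (Submodule.smul_mem _ (ξ 0) h1)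
    rwa [sub_add_cancel] at this
  have h1 : finrank ℝ (LinearMap.range T) ≤ finrank ℝ M := LinearMap.finrank_range_le T
  rw [htop, finrank_top, finrank_euclideanSpace_fin] at h1
  omega

/-! ### The local side indicator of a compressing disc -/

set_option maxHeartbeats 400000 in
/-- **Local side indicator of a compressing disc at every point, with the boundary crossing.**
Let `H, F ⊆ X` be read on the open set `V ⊆ Ξ.source` of a maximal-atlas chart `Ξ` of the smooth
`4`-manifold `X` as `H = {Ξ⁰ = 0, Ξ¹ ≥ 0}`, `F = {Ξ⁰ = 0, Ξ¹ = 0}`, and let `d : 𝔻² → X` be a smooth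
embedding of the closed disc with `range d ⊆ H` and `range d ∩ F = d(∂𝔻²)`.  For `z₀` with
`d z₀ ∈ V` there are an open `W ∋ d z₀` and `s : X → ℝ` forming a local side indicator of
`range d` inside `H` (`IsLocalSide H (range d) W s`); if moreover `d z₀ ∈ F`, then `(W, s)` is also
a local side indicator of `δ = range d ∩ F` inside `F`, and there is an arc
`γ : [-τ, τ] → F ∩ W` through `γ 0 = d z₀`, off `range d` for `t ≠ 0`, with `s (γ t) = -sign t`.
[cite: HirschDT1976, Ch. 4, Thm. 4.2 and §6] -/
theorem exists_isLocalSide_of_disc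
    {X : Type*} [TopologicalSpace X] [T2Space X] [ChartedSpace (EuclideanSpace ℝ (Fin 4)) X]
    [IsManifold (𝓡 4) ∞ X] {H F : Set X}
    {d : (Metric.closedBall (0 : EuclideanSpace ℝ (Fin 2)) 1) → X} (hd : IsSmoothEmbedding (𝓡∂ 2) (𝓡 4) ∞ d) (hDH : range d ⊆ H)
    (hDF : range d ∩ F = d '' {z | (𝓡∂ 2).IsBoundaryPoint z}) (z₀ : (Metric.closedBall (0 : EuclideanSpace ℝ (Fin 2)) 1))
    {Ξ : OpenPartialHomeomorph X (EuclideanSpace ℝ (Fin 4))}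
    (hΞ : Ξ ∈ IsManifold.maximalAtlas (𝓡 4) ∞ X)
    {V : Set X} (hV : IsOpen V) (hzV : d z₀ ∈ V) (hVΞ : V ⊆ Ξ.source)
    (hHV : ∀ x ∈ V, x ∈ H ↔ Ξ x 0 = 0 ∧ 0 ≤ Ξ x 1)
    (hFV : ∀ x ∈ V, x ∈ F ↔ Ξ x 0 = 0 ∧ Ξ x 1 = 0) :
    ∃ (W : Set X) (s : X → ℝ), d z₀ ∈ W ∧ IsLocalSide H (range d) W s ∧
      (d z₀ ∈ F → IsLocalSide F (range d ∩ F) W s ∧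
        ∃ (γ : ℝ → X) (τ : ℝ), 0 < τ ∧ ContinuousOn γ (Icc (-τ) τ) ∧ γ 0 = d z₀ ∧
          ∀ t ∈ Icc (-τ) τ, γ t ∈ F ∩ W ∧ (t ≠ 0 → γ t ∉ range d ∧ s (γ t) = -Real.sign t)) := by
  classical
  /- ── Step A: the half-space parametrisation of the disc read in `Ξ`. -/
  obtain ⟨E, G, u₀, Ω, hΩo, hu₀Ω, hEs, hDinj, hu₀0, hbdry₀, hGu₀, hGc, hGΞ, hlocim, hGinj, hGpt⟩ :=
    exists_halfSpaceParam_of_isSmoothEmbedding hd z₀ hΞ (hVΞ hzV)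
  have hdinj : Injective d := hd.isEmbedding.injective
  -- `G u ∈ range d`, and `G u ∈ F ↔ u 0 = 0`, on the half of `Ω`
  have hGd : ∀ u ∈ Ω, 0 ≤ u 0 → G u ∈ range d := by
    intro u hu hu0
    obtain ⟨x, hx, -⟩ := hGpt u hu hu0
    exact ⟨x, hx.symm⟩
  have hGF : ∀ u ∈ Ω, 0 ≤ u 0 → (G u ∈ F ↔ u 0 = 0) := by
    intro u hu hu0
    obtain ⟨x, hx, hxb⟩ := hGpt u hu hu0
    rw [← hxb, hx]
    constructor
    · intro hF
      have : d x ∈ range d ∩ F := ⟨mem_range_self x, hF⟩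
      rw [hDF] at this
      obtain ⟨x', hx', hxx'⟩ := this
      rwa [← hdinj hxx']
    · intro hb
      have : d x ∈ range d ∩ F := by rw [hDF]; exact ⟨x, hb, rfl⟩
      exact this.2
  -- a ball inside `Ω` mapped by `G` into `V`
  obtain ⟨r₀, hr₀, hball₀⟩ : ∃ r₀ > 0, ball u₀ r₀ ⊆ Ω ∩ G ⁻¹' V := by
    have hopen : IsOpen (Ω ∩ G ⁻¹' V) := hGc.isOpen_inter_preimage hΩo hV
    exact Metric.isOpen_iff.1 hopen u₀ ⟨hu₀Ω, by show G u₀ ∈ V; rwa [hGu₀]⟩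
  have hb₀Ω : ball u₀ r₀ ⊆ Ω := fun u hu => (hball₀ hu).1
  have hb₀V : ∀ u ∈ ball u₀ r₀, G u ∈ V := fun u hu => (hball₀ hu).2
  have hE0 : ∀ u ∈ ball u₀ r₀, 0 ≤ u 0 → E u 0 = 0 ∧ 0 ≤ E u 1 ∧ (E u 1 = 0 ↔ u 0 = 0) := by
    intro u hu hu0
    have huΩ := hb₀Ω hu
    have hGV := hb₀V u hu
    have hGH : G u ∈ H := hDH (hGd u huΩ hu0)
    rw [(hGΞ u huΩ).2]
    obtain ⟨h0, h1⟩ := (hHV _ hGV).1 hGH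
    refine ⟨h0, h1, ?_⟩
    rw [← hGF u huΩ hu0]
    constructor
    · intro h; exact (hFV _ hGV).2 ⟨h0, h⟩
    · intro h; exact ((hFV _ hGV).1 h).2
  /- ── Step B: the odd reflection across `{u 0 = 0}`. -/
  set ℓ : EuclideanSpace ℝ (Fin 2) →L[ℝ] ℝ := EuclideanSpace.proj 0 with hℓ
  set v : EuclideanSpace ℝ (Fin 2) := EuclideanSpace.single 0 1 with hv
  have hℓapply : ∀ u : EuclideanSpace ℝ (Fin 2), ℓ u = u 0 := fun u => rfl
  have hℓv : ℓ v = 1 := by simp [hℓ, hv]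
  have hv0 : v 0 = 1 := by simp [hv]
  have hcoord_sub : ∀ (u : EuclideanSpace ℝ (Fin 2)) (c : ℝ) (i : Fin 2),
      (u - c • v) i = u i - c * v i := fun u c i => by simp [hv]
  set Et : EuclideanSpace ℝ (Fin 2) → EuclideanSpace ℝ (Fin 4) := fun u =>
    if 0 ≤ ℓ u then E u else (2 : ℝ) • E (u - ℓ u • v) - E (u - (2 * ℓ u) • v) with hEt
  have hEt₁ : ∀ u, 0 ≤ ℓ u → Et u = E u := fun u hu => by simp [hEt, hu]
  have hEt₂ : ∀ u, ℓ u < 0 → Et u = (2 : ℝ) • E (u - ℓ u • v) - E (u - (2 * ℓ u) • v) :=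
    fun u hu => by simp [hEt, hu.not_ge]
  -- reflection geometry of balls centred on the hyperplane
  have hrefl_ball : u₀ 0 = 0 → ∀ (c : ℝ) (u : EuclideanSpace ℝ (Fin 2)), u ∈ ball u₀ r₀ →
      (c = u 0 ∨ c = 2 * u 0) → u - c • v ∈ ball u₀ r₀ := by
    intro h00 c u hu hc
    rw [mem_ball, dist_eq_norm] at hu ⊢
    have hsq : ∀ w : EuclideanSpace ℝ (Fin 2), ‖w‖ ^ 2 = w 0 ^ 2 + w 1 ^ 2 := by
      intro w
      rw [EuclideanSpace.norm_eq, Real.sq_sqrt (Finset.sum_nonneg fun i _ => sq_nonneg _),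
        Fin.sum_univ_two]
      simp [sq_abs]
    have h1 : ‖u - c • v - u₀‖ ^ 2 ≤ ‖u - u₀‖ ^ 2 := by
      rw [hsq, hsq]
      have e0 : (u - c • v - u₀) 0 = u 0 - c := by
        simp [hv, h00]
      have e1 : (u - c • v - u₀) 1 = (u - u₀) 1 := by
        simp [hv]
      have e2 : (u - u₀) 0 = u 0 := by simp [h00]
      rw [e0, e1, e2]
      rcases hc with rfl | rfl <;> nlinarith
    nlinarith [norm_nonneg (u - c • v - u₀), norm_nonneg (u - u₀)]
  -- an analytic radius `r₁`
  obtain ⟨r₁, hr₁, hr₁₀, hEtC1, hEtd, hsignball⟩ : ∃ r₁ > 0, r₁ ≤ r₀ ∧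
      ContDiffOn ℝ 1 Et (ball u₀ r₁) ∧ HasFDerivAt Et (fderiv ℝ E u₀) u₀ ∧
      ∀ u ∈ ball u₀ r₁, u 0 < 0 → u₀ 0 = 0 := by
    by_cases h00 : u₀ 0 = 0
    · -- boundary point: reflect
      have hUr : ∀ u ∈ ball u₀ r₀, u - ℓ u • v ∈ ball u₀ r₀ := fun u hu =>
        hrefl_ball h00 _ u hu (Or.inl rfl)
      have hUR : ∀ u ∈ ball u₀ r₀, u - (2 * ℓ u) • v ∈ ball u₀ r₀ := fun u hu =>
        hrefl_ball h00 _ u hu (Or.inr rfl)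
      have hEC1 : ContDiffOn ℝ 1 E (ball u₀ r₀) := (hEs.mono hb₀Ω).of_le (by exact_mod_cast le_top)
      refine ⟨r₀, hr₀, le_rfl, contDiffOn_one_of_oddReflection isOpen_ball hUr hUR hEC1 hEt₁ hEt₂,
        hasFDerivAt_of_oddReflection isOpen_ball hUr hUR hEC1 hEt₁ hEt₂ (mem_ball_self hr₀)
          (by rw [hℓapply, h00]),
        fun _ _ _ => h00⟩
    · -- interior point: the small ball lies in the open half-space
      have hpos : 0 < u₀ 0 := lt_of_le_of_ne hu₀0 (Ne.symm h00)
      set r₁ := min r₀ (u₀ 0) with hr₁_def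
      have hr₁ : 0 < r₁ := lt_min hr₀ hpos
      have hsub : ball u₀ r₁ ⊆ ball u₀ r₀ := ball_subset_ball (min_le_left _ _)
      have hposball : ∀ u ∈ ball u₀ r₁, 0 < u 0 := by
        intro u hu
        rw [mem_ball, dist_eq_norm] at hu
        have h1 : |(u - u₀) 0| ≤ ‖u - u₀‖ := by
          simpa [Real.norm_eq_abs] using PiLp.norm_apply_le (u - u₀) 0
        have h2 : (u - u₀) 0 = u 0 - u₀ 0 := rfl
        rw [h2] at h1
        have := (abs_le.1 h1).1
        linarith [min_le_right r₀ (u₀ 0)]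
      have heq : EqOn Et E (ball u₀ r₁) := fun u hu => hEt₁ u (hposball u hu).le
      have hEC1 : ContDiffOn ℝ 1 E (ball u₀ r₁) :=
        (hEs.mono (hsub.trans hb₀Ω)).of_le (by exact_mod_cast le_top)
      have hEd : HasFDerivAt E (fderiv ℝ E u₀) u₀ :=
        (((hEs.differentiableOn (by simp)).differentiableAt (hΩo.mem_nhds hu₀Ω))).hasFDerivAt
      refine ⟨r₁, hr₁, min_le_left _ _, hEC1.congr heq, ?_, fun u hu hneg =>
        absurd hneg (hposball u hu).not_gt⟩
      exact hEd.congr_of_eventuallyEq (eventuallyEq_of_mem (isOpen_ball.mem_nhds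
        (mem_ball_self hr₁)) heq)
  have hb₁₀ : ball u₀ r₁ ⊆ ball u₀ r₀ := ball_subset_ball hr₁₀
  /- ── Step C: coordinates `0` and `1` of `Et`; the function `μ`. -/
  set μ : EuclideanSpace ℝ (Fin 2) → ℝ := fun u => Et u 1 with hμ
  have hEt0 : ∀ u ∈ ball u₀ r₁, Et u 0 = 0 := by
    intro u hu
    rcases le_or_gt 0 (u 0) with h | h
    · rw [hEt₁ u h]; exact (hE0 u (hb₁₀ hu) h).1
    · have h00 := hsignball u hu h
      rw [hEt₂ u h]
      have hr := hrefl_ball h00 (u 0) u (hb₁₀ hu) (Or.inl rfl)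
      have hR := hrefl_ball h00 (2 * u 0) u (hb₁₀ hu) (Or.inr rfl)
      have hr0 : 0 ≤ (u - ℓ u • v) 0 := by rw [hcoord_sub, hℓapply, hv0]; simp
      have hR0 : 0 ≤ (u - (2 * ℓ u) • v) 0 := by
        rw [hcoord_sub, hℓapply, hv0]; nlinarith
      have e1 := (hE0 _ hr hr0).1
      have e2 := (hE0 _ hR hR0).1
      simp only [PiLp.sub_apply, PiLp.smul_apply, smul_eq_mul]
      simp only [hℓapply] at e1 e2 ⊢
      rw [e1, e2]; ring
  have hμpos : ∀ u ∈ ball u₀ r₁, 0 < u 0 → 0 < μ u := by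
    intro u hu h
    show 0 < Et u 1
    rw [hEt₁ u h.le]
    have := hE0 u (hb₁₀ hu) h.le
    exact lt_of_le_of_ne this.2.1 (fun h' => h.ne' (this.2.2.1 h'.symm))
  have hμzero : ∀ u ∈ ball u₀ r₁, u 0 = 0 → μ u = 0 := by
    intro u hu h
    show Et u 1 = 0
    rw [hEt₁ u h.ge]
    exact (hE0 u (hb₁₀ hu) h.ge).2.2.2 h
  have hμneg : ∀ u ∈ ball u₀ r₁, u 0 < 0 → μ u < 0 := by
    intro u hu h
    have h00 := hsignball u hu h
    show Et u 1 < 0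
    rw [hEt₂ u h]
    have hr := hrefl_ball h00 (u 0) u (hb₁₀ hu) (Or.inl rfl)
    have hR := hrefl_ball h00 (2 * u 0) u (hb₁₀ hu) (Or.inr rfl)
    have hr0 : (u - ℓ u • v) 0 = 0 := by rw [hcoord_sub, hℓapply, hv0]; simp
    have hR0 : 0 < (u - (2 * ℓ u) • v) 0 := by
      rw [hcoord_sub, hℓapply, hv0]; nlinarith
    have e1 : E (u - ℓ u • v) 1 = 0 := ((hE0 _ hr hr0.ge).2.2).2 hr0
    have e2 : 0 < E (u - (2 * ℓ u) • v) 1 := by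
      have := hE0 _ hR hR0.le
      exact lt_of_le_of_ne this.2.1 (fun h' => hR0.ne' (this.2.2.1 h'.symm))
    simp only [PiLp.sub_apply, PiLp.smul_apply, smul_eq_mul]
    simp only [hℓapply] at e1 e2 ⊢
    rw [e1]; linarith
  have hμnonneg : ∀ u ∈ ball u₀ r₁, 0 ≤ u 0 → 0 ≤ μ u := by
    intro u hu h
    rcases h.lt_or_eq with h | h
    · exact (hμpos u hu h).le
    · exact (hμzero u hu h.symm).ge
  have hμnonpos : ∀ u ∈ ball u₀ r₁, u 0 ≤ 0 → μ u ≤ 0 := by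
    intro u hu h
    rcases h.lt_or_eq with h | h
    · exact (hμneg u hu h).le
    · exact (hμzero u hu h).le
  have hμu₀ : 0 ≤ μ u₀ := hμnonneg u₀ (mem_ball_self hr₁) hu₀0
  have hμc : ContinuousOn μ (ball u₀ r₁) :=
    (continuous_apply 1).comp_continuousOn
      ((PiLp.continuous_ofLp 2 _).comp_continuousOn hEtC1.continuousOn)
  /- ── Step D: derivative facts. -/
  set D : EuclideanSpace ℝ (Fin 2) →L[ℝ] EuclideanSpace ℝ (Fin 4) := fderiv ℝ E u₀ with hD
  have hD0 : ∀ w, D w 0 = 0 := by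
    intro w
    -- `ξ⁰ ∘ Et` vanishes near `u₀`
    have h1 : HasFDerivAt (fun u => Et u 0) ((EuclideanSpace.proj 0).comp D) u₀ := by
      have := ((EuclideanSpace.proj (0 : Fin 4)).hasFDerivAt).comp u₀ hEtd
      simpa [Function.comp_def] using this
    have h2 : HasFDerivAt (fun u => Et u 0) (0 : EuclideanSpace ℝ (Fin 2) →L[ℝ] ℝ) u₀ := by
      refine (hasFDerivAt_const (0 : ℝ) u₀).congr_of_eventuallyEq ?_
      filter_upwards [isOpen_ball.mem_nhds (mem_ball_self hr₁)] with u hu using hEt0 u hu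
    have := h1.unique h2
    exact congrArg (fun T : EuclideanSpace ℝ (Fin 2) →L[ℝ] ℝ => T w) this
  set e₀ : EuclideanSpace ℝ (Fin 4) := EuclideanSpace.single 0 1 with he₀
  have he₀0 : e₀ 0 = 1 := by simp [he₀]
  have he₀1 : e₀ 1 = 0 := by simp [he₀]
  have he₀D :
      e₀ ∉ LinearMap.range (D : EuclideanSpace ℝ (Fin 2) →ₗ[ℝ] EuclideanSpace ℝ (Fin 4)) := by
    rintro ⟨w, hw⟩
    have := hD0 w
    rw [show D w = e₀ from hw, he₀0] at this
    exact one_ne_zero this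
  -- the thickened derivative and the transverse vector `n`
  set D' : (EuclideanSpace ℝ (Fin 2) × ℝ) →L[ℝ] EuclideanSpace ℝ (Fin 4) :=
    D.comp (ContinuousLinearMap.fst ℝ _ ℝ) + (ContinuousLinearMap.snd ℝ _ ℝ).smulRight e₀ with hD'
  have hD'inj : Injective D' := injective_thickeningDeriv hDinj he₀D
  obtain ⟨n, hn0, hn1, hnD'⟩ : ∃ n : EuclideanSpace ℝ (Fin 4), n 0 = 0 ∧ n 1 = 1 ∧
      n ∉ LinearMap.range (D' : (EuclideanSpace ℝ (Fin 2) × ℝ) →ₗ[ℝ] EuclideanSpace ℝ (Fin 4)) := by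
    refine exists_notMem_range_apply_eq ?_ _ ⟨((0 : EuclideanSpace ℝ (Fin 2)), (1 : ℝ)), ?_⟩
    · rw [Module.finrank_prod, finrank_euclideanSpace_fin, Module.finrank_self]; norm_num
    · show D' (0, 1) = e₀
      simp [hD']
  /- ── Step E: the thickening chart `Θ ((u, a), ν) = Et u + a • e₀ + ν • n`. -/
  set f : EuclideanSpace ℝ (Fin 2) × ℝ → EuclideanSpace ℝ (Fin 4) := fun q => Et q.1 + q.2 • e₀
    with hf
  have hfC1 : ContDiffAt ℝ 1 f (u₀, 0) := by
    have h1 : ContDiffAt ℝ 1 Et u₀ := hEtC1.contDiffAt (isOpen_ball.mem_nhds (mem_ball_self hr₁))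
    exact (h1.comp (u₀, (0 : ℝ)) contDiffAt_fst).add (contDiffAt_snd.smul contDiffAt_const)
  have hfd : HasFDerivAt f D' (u₀, 0) := hasFDerivAt_thickening hEtd e₀ 0
  have hdim :
      finrank ℝ (EuclideanSpace ℝ (Fin 2) × ℝ) + 1 = finrank ℝ (EuclideanSpace ℝ (Fin 4)) := by
    rw [Module.finrank_prod, finrank_euclideanSpace_fin, finrank_euclideanSpace_fin,
      Module.finrank_self]
  obtain ⟨Θ, hΘf, hΘsrc⟩ := exists_thickeningChart hfC1 hfd hD'inj hnD' hdim
  have hΘapply : ∀ q : (EuclideanSpace ℝ (Fin 2) × ℝ) × ℝ,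
      Θ q = Et q.1.1 + q.1.2 • e₀ + q.2 • n := fun q => by rw [hΘf q]
  have hΘ0 : ∀ q : (EuclideanSpace ℝ (Fin 2) × ℝ) × ℝ, q.1.1 ∈ ball u₀ r₁ → Θ q 0 = q.1.2 := by
    intro q hq
    rw [hΘapply]
    simp only [PiLp.add_apply, PiLp.smul_apply, smul_eq_mul, hEt0 _ hq, he₀0, hn0]
    ring
  have hΘ1 : ∀ q : (EuclideanSpace ℝ (Fin 2) × ℝ) × ℝ, Θ q 1 = μ q.1.1 + q.2 := by
    intro q
    rw [hΘapply]
    simp only [PiLp.add_apply, PiLp.smul_apply, smul_eq_mul, he₀1, hn1, hμ]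
    ring
  /- ── Step F: the product box `Q` and the open set `W`. -/
  obtain ⟨r, hr, hrr₁, hQsrc⟩ : ∃ r > 0, r ≤ r₁ ∧
      (ball u₀ r ×ˢ Ioo (-r) r) ×ˢ Ioo (-r) r ⊆ Θ.source := by
    obtain ⟨ρ, hρ, hρsub⟩ := exists_box_subset (Θ.open_source.mem_nhds hΘsrc)
    exact ⟨min ρ r₁, lt_min hρ hr₁, min_le_right _ _,
      (box_mono (min_le_left _ _) (min_le_left _ _)).trans hρsub⟩
  set Q : Set ((EuclideanSpace ℝ (Fin 2) × ℝ) × ℝ) := (ball u₀ r ×ˢ Ioo (-r) r) ×ˢ Ioo (-r) r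
    with hQ_def
  have hQo : IsOpen Q := isOpen_box u₀ r r
  have hQu : ∀ q ∈ Q, q.1.1 ∈ ball u₀ r₁ := fun q hq => ball_subset_ball hrr₁ hq.1.1
  have hu₀Q : ((u₀, (0 : ℝ)), (0 : ℝ)) ∈ Q :=
    ⟨⟨mem_ball_self hr, by simp [hr]⟩, by simp [hr]⟩
  -- the local image of the disc for the `u`-ball of `Q`
  obtain ⟨V', hV'o, hzV', hV'Ξ, hV'im⟩ := hlocim (ball u₀ r) ((ball_subset_ball hrr₁).trans
    (hb₁₀.trans hb₀Ω)) isOpen_ball (mem_ball_self hr)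
  set W : Set X := {x | x ∈ V ∩ V' ∧ Ξ x ∈ Θ '' Q} with hW_def
  have hΘQo : IsOpen (Θ '' Q) := Θ.isOpen_image_of_subset_source hQo hQsrc
  have hWo : IsOpen W := by
    have hc : ContinuousOn Ξ (V ∩ V') := Ξ.continuousOn.mono (inter_subset_left.trans hVΞ)
    exact hc.isOpen_inter_preimage (hV.inter hV'o) hΘQo
  have hWV : W ⊆ V := fun x hx => hx.1.1
  have hWsrc : W ⊆ Ξ.source := fun x hx => hVΞ hx.1.1
  -- `Φ = Θ⁻¹ ∘ Ξ` and `Ψ = Ξ⁻¹ ∘ Θ`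
  set Φ : X → (EuclideanSpace ℝ (Fin 2) × ℝ) × ℝ := fun x => Θ.symm (Ξ x) with hΦ
  set Ψ : (EuclideanSpace ℝ (Fin 2) × ℝ) × ℝ → X := fun q => Ξ.symm (Θ q) with hΨ
  set s : X → ℝ := fun x => Real.sign (Φ x).2 with hs_def
  have hΦW : ∀ x ∈ W, Φ x ∈ Q ∧ Θ (Φ x) = Ξ x := by
    intro x hx
    obtain ⟨q, hq, hqx⟩ := hx.2
    have : Φ x = q := by rw [hΦ]; simp only; rw [← hqx, Θ.left_inv (hQsrc hq)]
    rw [this]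
    exact ⟨hq, hqx⟩
  have hΞsymm : ∀ x ∈ W, Ξ.symm (Ξ x) = x := fun x hx => Ξ.left_inv (hWsrc hx)
  -- coordinates of the points of `W`
  have hΞ0 : ∀ x ∈ W, Ξ x 0 = (Φ x).1.2 := fun x hx => by
    rw [← (hΦW x hx).2, hΘ0 _ (hQu _ (hΦW x hx).1)]
  have hΞ1 : ∀ x ∈ W, Ξ x 1 = μ (Φ x).1.1 + (Φ x).2 := fun x hx => by
    rw [← (hΦW x hx).2, hΘ1]
  have hWH : ∀ x ∈ W, x ∈ H ↔ (Φ x).1.2 = 0 ∧ 0 ≤ μ (Φ x).1.1 + (Φ x).2 := fun x hx => by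
    rw [hHV x (hWV hx), hΞ0 x hx, hΞ1 x hx]
  have hWF : ∀ x ∈ W, x ∈ F ↔ (Φ x).1.2 = 0 ∧ μ (Φ x).1.1 + (Φ x).2 = 0 := fun x hx => by
    rw [hFV x (hWV hx), hΞ0 x hx, hΞ1 x hx]
  -- points of the disc in `W` have coordinates `((u, 0), 0)`, `u` in the half ball
  have hDW : ∀ x ∈ W, x ∈ range d → ∃ u ∈ ball u₀ r, 0 ≤ u 0 ∧ Φ x = ((u, 0), 0) ∧ x = G u ∧
      Ξ x = E u := by
    intro x hx hxd
    have : x ∈ range d ∩ V' := ⟨hxd, hx.1.2⟩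
    rw [hV'im] at this
    obtain ⟨u, ⟨hu, hu0⟩, rfl⟩ := this
    have huΩ : u ∈ Ω := hb₀Ω (hb₁₀ (ball_subset_ball hrr₁ hu))
    have hΞE : Ξ (G u) = E u := (hGΞ u huΩ).2.symm
    have hq : ((u, (0 : ℝ)), (0 : ℝ)) ∈ Q := ⟨⟨hu, by simp [hr]⟩, by simp [hr]⟩
    have hΘq : Θ ((u, (0 : ℝ)), (0 : ℝ)) = E u := by
      rw [hΘapply]; simp [hEt₁ u (by rw [hℓapply]; exact hu0)]
    refine ⟨u, hu, hu0, ?_, rfl, hΞE⟩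
    show Θ.symm (Ξ (G u)) = _
    rw [hΞE, ← hΘq, Θ.left_inv (hQsrc hq)]
  -- conversely, points of `W ∩ H` with `ν = 0` are on the disc
  have hDW' : ∀ x ∈ W, x ∈ H → (Φ x).2 = 0 → x ∈ range d := by
    intro x hx hxH hν
    obtain ⟨ha, hμν⟩ := (hWH x hx).1 hxH
    set u := (Φ x).1.1 with hu_def
    have hu : u ∈ ball u₀ r₁ := hQu _ (hΦW x hx).1
    have hμu : 0 ≤ μ u := by rw [hν, add_zero] at hμν; exact hμν
    have hu0 : 0 ≤ u 0 := by
      by_contra h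
      exact (hμneg u hu (not_le.1 h)).not_ge hμu
    have hΞx : Ξ x = E u := by
      rw [← (hΦW x hx).2, hΘapply, show (Φ x).1.2 = 0 from ha, hν, zero_smul, zero_smul,
        add_zero, add_zero, hEt₁ u (by rw [hℓapply]; exact hu0)]
    have huΩ : u ∈ Ω := hb₀Ω (hb₁₀ hu)
    have : x = G u := by
      have h1 : Ξ x = Ξ (G u) := by rw [hΞx, (hGΞ u huΩ).2]
      exact Ξ.injOn (hWsrc hx) (hGΞ u huΩ).1 h1
    rw [this]
    exact hGd u huΩ hu0
  -- manufactured points: `Ψ q` for `q ∈ Q` with `Θ q ∈ Ξ '' (V ∩ V')`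
  have hΨ : ∀ q ∈ Q, Θ q ∈ Ξ '' (V ∩ V') →
      Ψ q ∈ W ∧ Φ (Ψ q) = q ∧ (Ψ q ∈ H ↔ q.1.2 = 0 ∧ 0 ≤ μ q.1.1 + q.2) ∧
        (Ψ q ∈ F ↔ q.1.2 = 0 ∧ μ q.1.1 + q.2 = 0) ∧ (Ψ q ∈ range d → q.2 = 0) ∧
        s (Ψ q) = Real.sign q.2 := by
    intro q hq hqim
    obtain ⟨x, hxVV', hx⟩ := hqim
    have hΨx : Ψ q = x := by
      show Ξ.symm (Θ q) = x
      rw [← hx, Ξ.left_inv (hVΞ hxVV'.1)]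
    have hxW : x ∈ W := ⟨hxVV', ⟨q, hq, hx.symm⟩⟩
    have hΦx : Φ x = q := by
      show Θ.symm (Ξ x) = q
      rw [hx, Θ.left_inv (hQsrc hq)]
    rw [hΨx]
    refine ⟨hxW, hΦx, by rw [hWH x hxW, hΦx], by rw [hWF x hxW, hΦx], fun hxd => ?_,
      by simp only [hs_def, hΦx]⟩
    obtain ⟨u, -, -, hΦu, -⟩ := hDW x hxW hxd
    rw [hΦx] at hΦu
    rw [hΦu]
  -- small boxes around the disc points, mapped into prescribed neighbourhoods
  have hboxes : ∀ y ∈ W, y ∈ range d → ∀ U' ∈ 𝓝 y, ∃ u, u ∈ ball u₀ r ∧ 0 ≤ u 0 ∧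
      Φ y = ((u, 0), 0) ∧ Ξ y = E u ∧ Θ ((u, (0 : ℝ)), (0 : ℝ)) = Ξ y ∧ ∃ ρ > 0,
      (ball u ρ ×ˢ Ioo (-ρ) ρ) ×ˢ Ioo (-ρ) ρ ⊆ Q ∧
      ∀ q ∈ (ball u ρ ×ˢ Ioo (-ρ) ρ) ×ˢ Ioo (-ρ) ρ, Θ q ∈ Ξ '' (V ∩ V') ∧ Ψ q ∈ U' := by
    intro y hy hyd U' hU'
    obtain ⟨u, hu, hu0, hΦy, -, hΞy⟩ := hDW y hy hyd
    have hq₀ : ((u, (0 : ℝ)), (0 : ℝ)) ∈ Q := by rw [← hΦy]; exact (hΦW y hy).1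
    have hΘq₀ : Θ ((u, (0 : ℝ)), (0 : ℝ)) = Ξ y := by rw [← hΦy]; exact (hΦW y hy).2
    -- the neighbourhood `Ξ '' (U' ∩ W)` of `Ξ y`, pulled back by `Θ`
    have hN : Ξ '' (U' ∩ W) ∈ 𝓝 (Θ ((u, (0 : ℝ)), (0 : ℝ))) := by
      rw [hΘq₀]
      exact Ξ.image_mem_nhds (hWsrc hy) (inter_mem hU' (hWo.mem_nhds hy))
    have hpre : Θ ⁻¹' (Ξ '' (U' ∩ W)) ∩ Q ∈ 𝓝 ((u, (0 : ℝ)), (0 : ℝ)) :=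
      inter_mem ((Θ.continuousAt (hQsrc hq₀)).preimage_mem_nhds hN) (hQo.mem_nhds hq₀)
    obtain ⟨ρ, hρ, hρsub⟩ := exists_box_subset hpre
    refine ⟨u, hu, hu0, hΦy, hΞy, hΘq₀, ρ, hρ, fun q hq => (hρsub hq).2, fun q hq => ?_⟩
    obtain ⟨⟨x, hxUW, hx⟩, hqQ⟩ := hρsub hq
    refine ⟨⟨x, hxUW.2.1, hx⟩, ?_⟩
    show Ξ.symm (Θ q) ∈ U'
    rw [← hx, Ξ.left_inv (hWsrc hxUW.2)]
    exact hxUW.1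
  /- ── Step G: the point `d z₀` and continuity of `Φ`, `Ψ`. -/
  have hz₀W : d z₀ ∈ W := by
    refine ⟨⟨hzV, hzV'⟩, ((u₀, 0), 0), hu₀Q, ?_⟩
    rw [hΘapply]
    simp [hEt₁ u₀ (by rw [hℓapply]; exact hu₀0), ← hGu₀, (hGΞ u₀ hu₀Ω).2]
  have hΦc : ∀ x ∈ W, ContinuousAt Φ x := by
    intro x hx
    have h1 : ContinuousAt Ξ x := Ξ.continuousAt (hWsrc hx)
    have h2 : ContinuousAt Θ.symm (Ξ x) := by
      refine Θ.symm.continuousAt ?_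
      rw [Θ.symm_source, ← (hΦW x hx).2]
      exact Θ.map_source (hQsrc (hΦW x hx).1)
    exact h2.comp h1
  have hΨc : ∀ q ∈ Q, Θ q ∈ Ξ '' (V ∩ V') → ContinuousAt Ψ q := by
    intro q hq hqim
    have h1 : ContinuousAt Θ q := Θ.continuousAt (hQsrc hq)
    have h2 : ContinuousAt Ξ.symm (Θ q) := by
      refine Ξ.symm.continuousAt ?_
      obtain ⟨x, hx, hxq⟩ := hqim
      rw [Ξ.symm_source, ← hxq]
      exact Ξ.map_source (hVΞ hx.1)
    exact h2.comp h1
  have hΨcont : ContinuousOn Ψ {q ∈ Q | Θ q ∈ Ξ '' (V ∩ V')} := fun q hq =>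
    (hΨc q hq.1 hq.2).continuousWithinAt
  /- ── Step H: the local side indicator inside `H`. -/
  have hsign : ∀ x ∈ W, x ∈ H → x ∉ range d → s x = 1 ∨ s x = -1 := fun x hx hxH hxd =>
    sign_eq_one_or_of_ne_zero fun h => hxd (hDW' x hx hxH h)
  have hev : ∀ x ∈ W, x ∈ H → x ∉ range d → ∀ᶠ z in 𝓝 x, s z = s x := fun x hx hxH hxd =>
    eventually_realSign_comp_eq ((continuousAt_snd.comp (hΦc x hx)))
      fun h => hxd (hDW' x hx hxH h)
  -- membership characterisation of the punctured product neighbourhoods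
  have hchar : ∀ (u : EuclideanSpace ℝ (Fin 2)) (ρ₁ ε : ℝ),
      (∀ q ∈ (ball u ρ₁ ×ˢ Ioo (-ρ₁) ρ₁) ×ˢ Ioo (-ε) ε, q ∈ Q ∧ Θ q ∈ Ξ '' (V ∩ V')) →
      ∀ x, (x ∈ W ∧ Ξ x ∈ Θ '' ((ball u ρ₁ ×ˢ Ioo (-ρ₁) ρ₁) ×ˢ Ioo (-ε) ε) ∧ x ∈ H ∧
        x ∉ range d) ↔ ∃ u' ν, u' ∈ ball u ρ₁ ∧ ν ∈ Ioo (-ε) ε ∧ ν ≠ 0 ∧ 0 ≤ μ u' + ν ∧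
          x = Ψ ((u', 0), ν) := by
    intro u ρ₁ ε hgood x
    constructor
    · rintro ⟨hxW, ⟨q, hq, hqx⟩, hxH, hxd⟩
      have hqQ : q ∈ Q := (hgood q hq).1
      have hΦx : Φ x = q := by
        show Θ.symm (Ξ x) = q; rw [← hqx, Θ.left_inv (hQsrc hqQ)]
      obtain ⟨ha, hμν⟩ := (hWH x hxW).1 hxH
      rw [hΦx] at ha hμν
      refine ⟨q.1.1, q.2, hq.1.1, hq.2, fun h => hxd (hDW' x hxW hxH (by rw [hΦx]; exact h)),
        hμν, ?_⟩
      have hq' : q = ((q.1.1, 0), q.2) := by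
        ext <;> simp [← ha]
      show x = Ξ.symm (Θ ((q.1.1, 0), q.2))
      rw [← hq', hqx, hΞsymm x hxW]
    · rintro ⟨u', ν, hu', hν, hν0, hμν, rfl⟩
      have hqbox : ((u', (0 : ℝ)), ν) ∈ (ball u ρ₁ ×ˢ Ioo (-ρ₁) ρ₁) ×ˢ Ioo (-ε) ε := by
        refine ⟨⟨hu', ?_⟩, hν⟩
        have : 0 < ρ₁ := lt_of_le_of_lt dist_nonneg (mem_ball.1 hu')
        simp [this]
      obtain ⟨hqQ, hqim⟩ := hgood _ hqbox
      obtain ⟨hW', hΦq, hH', -, hd', -⟩ := hΨ _ hqQ hqim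
      refine ⟨hW', ⟨_, hqbox, ?_⟩, hH'.2 ⟨rfl, hμν⟩, fun h => hν0 (hd' h)⟩
      have := (hΦW _ hW').2
      rwa [hΦq] at this
  -- sign of a manufactured point
  have hsΨ : ∀ (u : EuclideanSpace ℝ (Fin 2)) (ρ₁ ε : ℝ),
      (∀ q ∈ (ball u ρ₁ ×ˢ Ioo (-ρ₁) ρ₁) ×ˢ Ioo (-ε) ε, q ∈ Q ∧ Θ q ∈ Ξ '' (V ∩ V')) →
      ∀ u' ∈ ball u ρ₁, ∀ ν ∈ Ioo (-ε) ε,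
        s (Ψ ((u', 0), ν)) = Real.sign ν ∧ (Ψ ((u', 0), ν) ∈ F ↔ μ u' + ν = 0) := by
    intro u ρ₁ ε hgood u' hu' ν hν
    have hqbox : ((u', (0 : ℝ)), ν) ∈ (ball u ρ₁ ×ˢ Ioo (-ρ₁) ρ₁) ×ˢ Ioo (-ε) ε := by
      refine ⟨⟨hu', ?_⟩, hν⟩
      have : 0 < ρ₁ := lt_of_le_of_lt dist_nonneg (mem_ball.1 hu')
      simp [this]
    obtain ⟨hqQ, hqim⟩ := hgood _ hqbox
    obtain ⟨-, -, -, hF', -, hs'⟩ := hΨ _ hqQ hqim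
    exact ⟨hs', by rw [hF']; simp⟩
  /- ── Step H: small product neighbourhoods of the disc points. -/
  have hlocal : ∀ y ∈ W, y ∈ range d → ∀ U' ∈ 𝓝 y, ∃ (u : EuclideanSpace ℝ (Fin 2)) (ρ ρ' : ℝ),
      u ∈ ball u₀ r ∧ 0 ≤ u 0 ∧ Φ y = ((u, 0), 0) ∧ Θ ((u, (0 : ℝ)), (0 : ℝ)) = Ξ y ∧
      0 < ρ ∧ 0 < ρ' ∧ ρ' ≤ ρ ∧ ball u ρ' ⊆ ball u₀ r₁ ∧
      (∀ q ∈ (ball u ρ' ×ˢ Ioo (-ρ') ρ') ×ˢ Ioo (-ρ) ρ,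
        q ∈ Q ∧ Θ q ∈ Ξ '' (V ∩ V') ∧ Ψ q ∈ U') ∧
      (∀ u' ∈ ball u ρ', dist (μ u') (μ u) < ρ / 2) ∧
      IsOpen {x | x ∈ W ∧ Ξ x ∈ Θ '' ((ball u ρ' ×ˢ Ioo (-ρ') ρ') ×ˢ Ioo (-ρ) ρ)} ∧
      y ∈ {x | x ∈ W ∧ Ξ x ∈ Θ '' ((ball u ρ' ×ˢ Ioo (-ρ') ρ') ×ˢ Ioo (-ρ) ρ)} ∧
      {x | x ∈ W ∧ Ξ x ∈ Θ '' ((ball u ρ' ×ˢ Ioo (-ρ') ρ') ×ˢ Ioo (-ρ) ρ)} ⊆ U' ∩ W := by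
    intro y hy hyd U' hU'
    obtain ⟨u, hu, hu0, hΦy, -, hΘq₀, ρ, hρ, hρQ, hρgood⟩ := hboxes y hy hyd U' hU'
    have hur₁ : u ∈ ball u₀ r₁ := ball_subset_ball hrr₁ hu
    -- `μ` varies by less than `ρ/2` on a smaller ball
    obtain ⟨ρ', hρ', hρ'ρ, hμvar⟩ : ∃ ρ' > 0, ρ' ≤ ρ ∧
        ∀ u' ∈ ball u ρ', dist (μ u') (μ u) < ρ / 2 := by
      have hca : ContinuousAt μ u := hμc.continuousAt (isOpen_ball.mem_nhds hur₁)
      obtain ⟨δ, hδ, hδμ⟩ := Metric.tendsto_nhds_nhds.1 hca (ρ / 2) (by linarith)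
      exact ⟨min δ ρ, lt_min hδ hρ, min_le_right _ _, fun u' hu' =>
        hδμ (lt_of_lt_of_le (mem_ball.1 hu') (min_le_left _ _))⟩
    have hBsub :
        (ball u ρ' ×ˢ Ioo (-ρ') ρ') ×ˢ Ioo (-ρ) ρ ⊆ (ball u ρ ×ˢ Ioo (-ρ) ρ) ×ˢ Ioo (-ρ) ρ :=
      box_mono hρ'ρ le_rfl
    have hgood : ∀ q ∈ (ball u ρ' ×ˢ Ioo (-ρ') ρ') ×ˢ Ioo (-ρ) ρ,
        q ∈ Q ∧ Θ q ∈ Ξ '' (V ∩ V') ∧ Ψ q ∈ U' := fun q hq =>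
      ⟨hρQ (hBsub hq), (hρgood q (hBsub hq)).1, (hρgood q (hBsub hq)).2⟩
    have hballr₁ : ball u ρ' ⊆ ball u₀ r₁ := by
      intro u' hu'
      have h1 : ((u', (0 : ℝ)), (0 : ℝ)) ∈ (ball u ρ' ×ˢ Ioo (-ρ') ρ') ×ˢ Ioo (-ρ) ρ :=
        ⟨⟨hu', by rw [mem_Ioo]; exact ⟨by linarith, hρ'⟩⟩, by rw [mem_Ioo]; exact ⟨by linarith, hρ⟩⟩
      have h2 : ((u', (0 : ℝ)), (0 : ℝ)) ∈ Q := (hgood _ h1).1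
      have h3 : ((u', (0 : ℝ)), (0 : ℝ)).1.1 ∈ ball u₀ r₁ := hQu _ h2
      exact h3
    refine ⟨u, ρ, ρ', hu, hu0, hΦy, hΘq₀, hρ, hρ', hρ'ρ, hballr₁, hgood, hμvar, ?_⟩
    refine ⟨?_, ?_, ?_⟩
    · exact (Ξ.continuousOn.mono hWsrc).isOpen_inter_preimage hWo
        (Θ.isOpen_image_of_subset_source (isOpen_box u ρ' ρ) ((hBsub.trans hρQ).trans hQsrc))
    · exact ⟨hy, ((u, 0), 0), ⟨⟨mem_ball_self hρ', by simp [hρ']⟩, by simp [hρ]⟩, hΘq₀⟩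
    · rintro x ⟨hxW, q, hq, hqx⟩
      refine ⟨?_, hxW⟩
      have hx : x = Ψ q := by
        show x = Ξ.symm (Θ q); rw [hqx, hΞsymm x hxW]
      rw [hx]
      exact (hgood q hq).2.2
  /- ── Step I: the local side indicator inside `H`. -/
  have hS_sign : ∀ x ∈ (W ∩ H) \ range d, s x = 1 ∨ s x = -1 := fun x hx =>
    hsign x hx.1.1 hx.1.2 hx.2
  have hS_ev : ∀ x ∈ (W ∩ H) \ range d, ∀ᶠ z in 𝓝[H] x, s z = s x := fun x hx =>
    mem_nhdsWithin_of_mem_nhds (hev x hx.1.1 hx.1.2 hx.2)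
  have hS_nhds : ∀ y ∈ range d ∩ W, ∀ U' ∈ 𝓝 y, ∃ Vy ∈ 𝓝 y, Vy ⊆ U' ∩ W ∧
      IsPreconnected {y' | y' ∈ (Vy ∩ H) \ range d ∧ s y' = 1} ∧
      IsPreconnected {y' | y' ∈ (Vy ∩ H) \ range d ∧ s y' = -1} := by
    intro y hy U' hU'
    obtain ⟨u, ρ, ρ', hu, hu0, hΦy, hΘq₀, hρ, hρ', hρ'ρ, hballr₁, hgood, hμvar, hVyo, hyVy, hVyU⟩ :=
      hlocal y hy.2 hy.1 U' hU'
    have hur₁ : u ∈ ball u₀ r₁ := ball_subset_ball hrr₁ hu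
    have hgood' : ∀ q ∈ (ball u ρ' ×ˢ Ioo (-ρ') ρ') ×ˢ Ioo (-ρ) ρ,
        q ∈ Q ∧ Θ q ∈ Ξ '' (V ∩ V') := fun q hq => ⟨(hgood q hq).1, (hgood q hq).2.1⟩
    set Vy := {x | x ∈ W ∧ Ξ x ∈ Θ '' ((ball u ρ' ×ˢ Ioo (-ρ') ρ') ×ˢ Ioo (-ρ) ρ)} with hVy
    have hΨon : ContinuousOn (fun p : EuclideanSpace ℝ (Fin 2) × ℝ => Ψ ((p.1, 0), p.2))
        {p | p.1 ∈ ball u ρ' ∧ p.2 ∈ Ioo (-ρ) ρ} := by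
      refine hΨcont.comp (Continuous.continuousOn (by fun_prop)) ?_
      rintro ⟨u', ν⟩ ⟨hu', hν⟩
      exact hgood' _ ⟨⟨hu', by simp [hρ']⟩, hν⟩
    -- both sides are images of the regions of the thickening chart
    have hside : ∀ σ : ℝ, (σ = 1 ∨ σ = -1) →
        {y' | y' ∈ (Vy ∩ H) \ range d ∧ s y' = σ} =
          (fun p : EuclideanSpace ℝ (Fin 2) × ℝ => Ψ ((p.1, 0), p.2)) ''
            {p | p.1 ∈ ball u ρ' ∧ p.2 ∈ Ioo (-ρ) ρ ∧ Real.sign p.2 = σ ∧ p.2 ≠ 0 ∧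
              0 ≤ μ p.1 + p.2} := by
      intro σ hσ
      ext x
      simp only [mem_setOf_eq, Set.mem_sdiff, mem_inter_iff, mem_image]
      constructor
      · rintro ⟨⟨⟨hxVy, hxH⟩, hxd⟩, hsx⟩
        obtain ⟨u', ν, hu', hν, hν0, hμν, rfl⟩ :=
          (hchar u ρ' ρ hgood' x).1 ⟨hxVy.1, hxVy.2, hxH, hxd⟩
        refine ⟨(u', ν), ⟨hu', hν, ?_, hν0, hμν⟩, rfl⟩
        rw [← hsx]
        exact ((hsΨ u ρ' ρ hgood' u' hu' ν hν).1).symm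
      · rintro ⟨⟨u', ν⟩, ⟨hu', hν, hsν, hν0, hμν⟩, rfl⟩
        obtain ⟨hxW, hxB, hxH, hxd⟩ :=
          (hchar u ρ' ρ hgood' _).2 ⟨u', ν, hu', hν, hν0, hμν, rfl⟩
        exact ⟨⟨⟨⟨hxW, hxB⟩, hxH⟩, hxd⟩, by rw [(hsΨ u ρ' ρ hgood' u' hu' ν hν).1, hsν]⟩
    refine ⟨Vy, hVyo.mem_nhds hyVy, hVyU, ?_, ?_⟩
    · rw [hside 1 (Or.inl rfl)]
      have hreg : {p : EuclideanSpace ℝ (Fin 2) × ℝ | p.1 ∈ ball u ρ' ∧ p.2 ∈ Ioo (-ρ) ρ ∧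
          Real.sign p.2 = 1 ∧ p.2 ≠ 0 ∧ 0 ≤ μ p.1 + p.2} =
          {p | p.1 ∈ ball u ρ' ∧ 0 < p.2 ∧ p.2 < ρ ∧ 0 ≤ μ p.1 + p.2} := by
        ext ⟨u', ν⟩
        simp only [mem_setOf_eq, mem_Ioo]
        constructor
        · rintro ⟨hu', hν, hs1, hν0, hμν⟩
          refine ⟨hu', ?_, hν.2, hμν⟩
          rcases lt_or_gt_of_ne hν0 with h | h
          · rw [Real.sign_of_neg h] at hs1; norm_num at hs1
          · exact h
        · rintro ⟨hu', hν0, hνρ, hμν⟩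
          exact ⟨hu', ⟨by linarith, hνρ⟩, Real.sign_of_pos hν0, hν0.ne', hμν⟩
      rw [hreg]
      refine (isPreconnected_upperSide_of_gt (convex_ball u ρ') fun u' hu' => ?_).image _
        (hΨon.mono fun p hp => ⟨hp.1, by exact ⟨by linarith [hp.2.1], hp.2.2.1⟩⟩)
      have := hμvar u' hu'
      rw [Real.dist_eq, abs_lt] at this
      linarith [hμnonneg u hur₁ hu0]
    · rw [hside (-1) (Or.inr rfl)]
      have hreg : {p : EuclideanSpace ℝ (Fin 2) × ℝ | p.1 ∈ ball u ρ' ∧ p.2 ∈ Ioo (-ρ) ρ ∧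
          Real.sign p.2 = -1 ∧ p.2 ≠ 0 ∧ 0 ≤ μ p.1 + p.2} =
          {p | p.1 ∈ ball u ρ' ∧ p.2 < 0 ∧ -ρ < p.2 ∧ 0 ≤ μ p.1 + p.2} := by
        ext ⟨u', ν⟩
        simp only [mem_setOf_eq, mem_Ioo]
        constructor
        · rintro ⟨hu', hν, hs1, hν0, hμν⟩
          refine ⟨hu', ?_, hν.1, hμν⟩
          rcases lt_or_gt_of_ne hν0 with h | h
          · exact h
          · rw [Real.sign_of_pos h] at hs1; norm_num at hs1
        · rintro ⟨hu', hν0, hνρ, hμν⟩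
          exact ⟨hu', ⟨hνρ, by linarith⟩, Real.sign_of_neg hν0, hν0.ne, hμν⟩
      rw [hreg]
      exact (isPreconnected_lowerSide (convex_ball u ρ') (hμc.mono hballr₁) hρ (ℓ := ℓ)
        (fun u' hu' h => hμpos u' (hballr₁ hu') h)
        (fun u' hu' h => hμnonpos u' (hballr₁ hu') h)).image _
        (hΨon.mono fun p hp => ⟨hp.1, by exact ⟨hp.2.2.1, by linarith [hp.2.1]⟩⟩)
  -- approach curves: a generic closure argument
  have hS_approach : ∀ y ∈ range d ∩ W, ∀ (P : Set X) (c : ℝ → (EuclideanSpace ℝ (Fin 2) × ℝ) × ℝ),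
      Tendsto c (𝓝[>] 0) (𝓝 (Φ y)) →
      (∀ᶠ t in 𝓝[>] (0 : ℝ), c t ∈ Q → Θ (c t) ∈ Ξ '' (V ∩ V') → Ψ (c t) ∈ P) →
      y ∈ closure P := by
    intro y hy P c hc hP
    obtain ⟨u, ρ, ρ', hu, hu0, hΦy, hΘq₀, hρ, hρ', hρ'ρ, hballr₁, hgood, -, -, -, -⟩ :=
      hlocal y hy.2 hy.1 univ univ_mem
    have hq₀ : Φ y ∈ Q := (hΦW y hy.2).1
    have hΨy : Ψ (Φ y) = y := by
      show Ξ.symm (Θ (Φ y)) = y; rw [(hΦW y hy.2).2, hΞsymm y hy.2]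
    have hΨca : ContinuousAt Ψ (Φ y) :=
      hΨc _ hq₀ ⟨y, (hy.2).1, ((hΦW y hy.2).2).symm⟩
    have hbox_ev : ∀ᶠ t in 𝓝[>] (0 : ℝ), c t ∈ (ball u ρ' ×ˢ Ioo (-ρ') ρ') ×ˢ Ioo (-ρ) ρ := by
      refine hc ((isOpen_box u ρ' ρ).mem_nhds ?_)
      rw [hΦy]
      exact ⟨⟨mem_ball_self hρ', by simp [hρ']⟩, by simp [hρ]⟩
    refine mem_closure_of_tendsto ((hΨca.tendsto.comp hc).congr' (Eventually.of_forall
      fun _ => rfl) |>.mono_right (by rw [hΨy])) ?_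
    filter_upwards [hbox_ev, hP] with t ht hPt
    exact hPt (hgood _ ht).1 (hgood _ ht).2.1
  have hS_closure : ∀ y ∈ range d ∩ W, ∀ σ : ℝ, σ = 1 ∨ σ = -1 →
      y ∈ closure {y' | y' ∈ (W ∩ H) \ range d ∧ s y' = σ} := by
    intro y hy σ hσ
    obtain ⟨u, hu, hu0, hΦy, -, -⟩ := hDW y hy.2 hy.1
    have hur₁ : u ∈ ball u₀ r₁ := ball_subset_ball hrr₁ hu
    have hμu : 0 ≤ μ u := hμnonneg u hur₁ hu0
    rcases hσ with rfl | rfl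
    · -- upper side: the vertical segment `t ↦ ((u, 0), t)`
      refine hS_approach y hy _ (fun t => ((u, 0), t)) ?_ ?_
      · rw [hΦy]
        refine tendsto_nhdsWithin_of_tendsto_nhds ?_
        have : Continuous fun t : ℝ => ((u, (0 : ℝ)), t) := by fun_prop
        simpa using this.tendsto 0
      · filter_upwards [(self_mem_nhdsWithin : Ioi (0:ℝ) ∈ 𝓝[>] (0 : ℝ))]
          with t htpos hqQ hqim
        have htpos : 0 < t := htpos
        obtain ⟨hW', -, hH', -, hd', hs'⟩ := hΨ _ hqQ hqim
        refine ⟨⟨⟨hW', hH'.2 ⟨rfl, ?_⟩⟩, fun h => htpos.ne' (hd' h)⟩, ?_⟩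
        · show 0 ≤ μ u + t
          linarith
        · show s (Ψ ((u, 0), t)) = 1
          rw [hs']
          exact Real.sign_of_pos htpos
    · -- lower side: move into `{u⁰ > 0}` (where `μ > 0`) and go down
      have hlin : Continuous fun t : ℝ => u + t • v := by fun_prop
      have hμt : ContinuousAt (fun t : ℝ => μ (u + t • v)) 0 := by
        refine (hμc.continuousAt ?_).comp hlin.continuousAt
        simpa using isOpen_ball.mem_nhds hur₁
      refine hS_approach y hy _
        (fun t => ((u + t • v, 0), -(min (μ (u + t • v)) t) / 2)) ?_ ?_
      · rw [hΦy]
        refine tendsto_nhdsWithin_of_tendsto_nhds ?_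
        have h1 : Tendsto (fun t : ℝ => ((u + t • v, (0 : ℝ)))) (𝓝 0) (𝓝 (u, 0)) := by
          have : Continuous fun t : ℝ => ((u + t • v, (0 : ℝ))) := by fun_prop
          simpa using this.tendsto 0
        have h2 : Tendsto (fun t : ℝ => -(min (μ (u + t • v)) t) / 2) (𝓝 0) (𝓝 0) := by
          have h3 := ((hμt.tendsto.min (continuous_id.tendsto (0 : ℝ))).neg).div_const 2
          have h4 : min (μ (u + (0 : ℝ) • v)) (id (0 : ℝ)) = 0 := by
            simpa using hμu
          rw [h4, neg_zero, zero_div] at h3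
          exact h3
        exact h1.prodMk_nhds h2
      · have hball_ev : ∀ᶠ t in 𝓝[>] (0 : ℝ), u + t • v ∈ ball u₀ r₁ :=
          tendsto_nhdsWithin_of_tendsto_nhds (hlin.tendsto' 0 u (by simp))
            (isOpen_ball.mem_nhds hur₁)
        filter_upwards [hball_ev, (self_mem_nhdsWithin : Ioi (0:ℝ) ∈ 𝓝[>] (0 : ℝ))]
          with t hballt htpos hqQ hqim
        have htpos : 0 < t := htpos
        obtain ⟨hW', -, hH', -, hd', hs'⟩ := hΨ _ hqQ hqim
        have hut : 0 < (u + t • v) 0 := by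
          have : (u + t • v) 0 = u 0 + t * v 0 := by simp
          rw [this, hv0]; linarith
        have hμpos' : 0 < μ (u + t • v) := hμpos _ hballt hut
        have hm : 0 < min (μ (u + t • v)) t := lt_min hμpos' htpos
        have hml : min (μ (u + t • v)) t ≤ μ (u + t • v) := min_le_left _ _
        refine ⟨⟨⟨hW', hH'.2 ⟨rfl, ?_⟩⟩, fun h => ?_⟩, ?_⟩
        · show 0 ≤ μ (u + t • v) + -(min (μ (u + t • v)) t) / 2
          linarith
        · have := hd' h
          simp only at this
          linarith
        · show s (Ψ ((u + t • v, 0), -(min (μ (u + t • v)) t) / 2)) = -1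
          rw [hs']
          exact Real.sign_of_neg (by linarith)
  refine ⟨W, s, hz₀W, ⟨hWo, hS_sign, hS_ev, hS_nhds, hS_closure⟩, fun hzF => ?_⟩
  /- ── Step J: the boundary case: sides inside `F` and the crossing arc. -/
  have hu₀00 : u₀ 0 = 0 := (hGF u₀ hu₀Ω hu₀0).1 (by rwa [hGu₀])
  -- `F ⊆ H` and `F \ (range d ∩ F) ⊆ H \ range d` on `W`
  have hFH : ∀ x ∈ W, x ∈ F → x ∈ H := fun x hx hxF => by
    rw [hWH x hx]; obtain ⟨ha, hμν⟩ := (hWF x hx).1 hxF; exact ⟨ha, hμν.ge⟩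
  have hFd : ∀ x, x ∈ F → x ∉ range d ∩ F → x ∉ range d := fun x hxF hxδ hxd => hxδ ⟨hxd, hxF⟩
  -- disc points of `F` have `u 0 = 0` and `μ = 0`
  have hδ0 : ∀ y ∈ W, y ∈ range d → y ∈ F → ∀ u, Φ y = ((u, 0), 0) → u 0 = 0 ∧ μ u = 0 := by
    intro y hy hyd hyF u hΦy
    obtain ⟨u', hu', hu'0, hΦy', hyG, -⟩ := hDW y hy hyd
    have huu' : u = u' := by
      have := hΦy.symm.trans hΦy'
      simpa using this
    subst huu'
    have huΩ : u ∈ Ω := hb₀Ω (hb₁₀ (ball_subset_ball hrr₁ hu'))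
    have hu00 : u 0 = 0 := (hGF u huΩ hu'0).1 (by rw [← hyG]; exact hyF)
    exact ⟨hu00, hμzero u (ball_subset_ball hrr₁ hu') hu00⟩
  have hδμ : ∀ y ∈ W, y ∈ range d → y ∈ F → ∀ u, Φ y = ((u, 0), 0) → μ u = 0 :=
    fun y hy hyd hyF u hΦy => (hδ0 y hy hyd hyF u hΦy).2
  have hF_nhds : ∀ y ∈ (range d ∩ F) ∩ W, ∀ U' ∈ 𝓝 y, ∃ Vy ∈ 𝓝 y, Vy ⊆ U' ∩ W ∧
      IsPreconnected {y' | y' ∈ (Vy ∩ F) \ (range d ∩ F) ∧ s y' = 1} ∧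
      IsPreconnected {y' | y' ∈ (Vy ∩ F) \ (range d ∩ F) ∧ s y' = -1} := by
    intro y hy U' hU'
    obtain ⟨u, ρ, ρ', hu, hu0, hΦy, hΘq₀, hρ, hρ', hρ'ρ, hballr₁, hgood, hμvar, hVyo, hyVy, hVyU⟩ :=
      hlocal y hy.2 hy.1.1 U' hU'
    have hμu : μ u = 0 := hδμ y hy.2 hy.1.1 hy.1.2 u hΦy
    have hgood' : ∀ q ∈ (ball u ρ' ×ˢ Ioo (-ρ') ρ') ×ˢ Ioo (-ρ) ρ,
        q ∈ Q ∧ Θ q ∈ Ξ '' (V ∩ V') := fun q hq => ⟨(hgood q hq).1, (hgood q hq).2.1⟩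
    set Vy := {x | x ∈ W ∧ Ξ x ∈ Θ '' ((ball u ρ' ×ˢ Ioo (-ρ') ρ') ×ˢ Ioo (-ρ) ρ)} with hVy
    have hμabs : ∀ u' ∈ ball u ρ', -μ u' ∈ Ioo (-ρ) ρ := by
      intro u' hu'
      have := hμvar u' hu'
      rw [Real.dist_eq, hμu, sub_zero, abs_lt] at this
      exact ⟨by linarith, by linarith⟩
    have hΨon : ContinuousOn (fun u' : EuclideanSpace ℝ (Fin 2) => Ψ ((u', 0), -μ u'))
        (ball u ρ') := by
      refine hΨcont.comp ?_ ?_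
      · exact ((continuousOn_id.prodMk continuousOn_const).prodMk
          ((hμc.mono hballr₁).neg))
      · intro u' hu'
        exact hgood' _ ⟨⟨hu', by simp [hρ']⟩, hμabs u' hu'⟩
    -- the two sides of `δ` inside `F` are graphs over the two half balls
    have hside : ∀ σ : ℝ, (σ = 1 ∨ σ = -1) →
        {y' | y' ∈ (Vy ∩ F) \ (range d ∩ F) ∧ s y' = σ} =
          (fun u' : EuclideanSpace ℝ (Fin 2) => Ψ ((u', 0), -μ u')) ''
            {u' | u' ∈ ball u ρ' ∧ Real.sign (-μ u') = σ ∧ u' 0 ≠ 0} := by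
      intro σ hσ
      ext x
      simp only [mem_setOf_eq, Set.mem_sdiff, mem_inter_iff, mem_image]
      constructor
      · rintro ⟨⟨⟨hxVy, hxF⟩, hxδ⟩, hsx⟩
        have hxH := hFH x hxVy.1 hxF
        have hxd := hFd x hxF hxδ
        obtain ⟨u', ν, hu', hν, hν0, hμν, rfl⟩ :=
          (hchar u ρ' ρ hgood' x).1 ⟨hxVy.1, hxVy.2, hxH, hxd⟩
        obtain ⟨hs', hF'⟩ := hsΨ u ρ' ρ hgood' u' hu' ν hν
        have hνμ : ν = -μ u' := by linarith [hF'.1 hxF]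
        subst hνμ
        refine ⟨u', ⟨hu', by rw [← hsx, hs'], fun h0 => hν0 ?_⟩, rfl⟩
        rw [hμzero u' (hballr₁ hu') h0, neg_zero]
      · rintro ⟨u', ⟨hu', hsσ, hu'0⟩, rfl⟩
        have hν0 : -μ u' ≠ 0 := by
          rcases lt_or_gt_of_ne hu'0 with h | h
          · linarith [hμneg u' (hballr₁ hu') h]
          · linarith [hμpos u' (hballr₁ hu') h]
        obtain ⟨hxW, hxB, hxH, hxd⟩ :=
          (hchar u ρ' ρ hgood' _).2 ⟨u', -μ u', hu', hμabs u' hu', hν0, by simp, rfl⟩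
        obtain ⟨hs', hF'⟩ := hsΨ u ρ' ρ hgood' u' hu' (-μ u') (hμabs u' hu')
        exact ⟨⟨⟨⟨hxW, hxB⟩, hF'.2 (by ring)⟩, fun h => hxd h.1⟩, by rw [hs', hsσ]⟩
    have hhalf : ∀ σ : ℝ, (σ = 1 ∨ σ = -1) →
        {u' : EuclideanSpace ℝ (Fin 2) | u' ∈ ball u ρ' ∧ Real.sign (-μ u') = σ ∧ u' 0 ≠ 0} =
          ball u ρ' ∩ {u' | 0 < -σ * ℓ u'} := by
      intro σ hσ
      ext u'
      simp only [mem_setOf_eq, mem_inter_iff, hℓapply]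
      constructor
      · rintro ⟨hu', hsσ, hu'0⟩
        refine ⟨hu', ?_⟩
        rcases lt_or_gt_of_ne hu'0 with h | h
        · have hμ' := hμneg u' (hballr₁ hu') h
          rw [Real.sign_of_pos (by linarith)] at hsσ
          rw [← hsσ]; linarith
        · have hμ' := hμpos u' (hballr₁ hu') h
          rw [Real.sign_of_neg (by linarith)] at hsσ
          rw [← hsσ]; linarith
      · rintro ⟨hu', hsl⟩
        refine ⟨hu', ?_, ?_⟩
        · rcases hσ with rfl | rfl
          · have h : u' 0 < 0 := by linarith
            exact Real.sign_of_pos (by linarith [hμneg u' (hballr₁ hu') h])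
          · have h : 0 < u' 0 := by linarith
            exact Real.sign_of_neg (by linarith [hμpos u' (hballr₁ hu') h])
        · rcases hσ with rfl | rfl <;> intro h0 <;> rw [h0] at hsl <;> simp at hsl
    have hpre : ∀ σ : ℝ, (σ = 1 ∨ σ = -1) →
        IsPreconnected {y' | y' ∈ (Vy ∩ F) \ (range d ∩ F) ∧ s y' = σ} := by
      intro σ hσ
      rw [hside σ hσ, hhalf σ hσ]
      refine (Convex.isPreconnected ?_).image _ (hΨon.mono inter_subset_left)
      exact (convex_ball u ρ').inter (convex_halfSpace_gt ((-σ) • ℓ).isLinear 0)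
    exact ⟨Vy, hVyo.mem_nhds hyVy, hVyU, hpre 1 (Or.inl rfl), hpre (-1) (Or.inr rfl)⟩
  have hF_closure : ∀ y ∈ (range d ∩ F) ∩ W, ∀ σ : ℝ, σ = 1 ∨ σ = -1 →
      y ∈ closure {y' | y' ∈ (W ∩ F) \ (range d ∩ F) ∧ s y' = σ} := by
    intro y hy σ hσ
    obtain ⟨u, hu, hu0, hΦy, -, -⟩ := hDW y hy.2 hy.1.1
    have hur₁ : u ∈ ball u₀ r₁ := ball_subset_ball hrr₁ hu
    obtain ⟨hu00, hμu⟩ := hδ0 y hy.2 hy.1.1 hy.1.2 u hΦy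
    have h1 : Continuous fun t : ℝ => u - (σ * t) • v := by fun_prop
    have hμt : ContinuousAt (fun t : ℝ => μ (u - (σ * t) • v)) 0 := by
      refine (hμc.continuousAt ?_).comp h1.continuousAt
      simpa using isOpen_ball.mem_nhds hur₁
    refine hS_approach y ⟨hy.1.1, hy.2⟩ _
      (fun t => ((u - (σ * t) • v, 0), -μ (u - (σ * t) • v))) ?_ ?_
    · rw [hΦy]
      refine tendsto_nhdsWithin_of_tendsto_nhds ?_
      have h2 : Tendsto (fun t : ℝ => ((u - (σ * t) • v, (0 : ℝ)))) (𝓝 0) (𝓝 (u, 0)) := by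
        have : Continuous fun t : ℝ => ((u - (σ * t) • v, (0 : ℝ))) := by fun_prop
        simpa using this.tendsto 0
      have h3 : Tendsto (fun t : ℝ => -μ (u - (σ * t) • v)) (𝓝 0) (𝓝 0) := by
        have := hμt.tendsto.neg
        simpa [hμu] using this
      exact h2.prodMk_nhds h3
    · have hball_ev : ∀ᶠ t in 𝓝[>] (0 : ℝ), u - (σ * t) • v ∈ ball u₀ r₁ :=
        tendsto_nhdsWithin_of_tendsto_nhds (h1.tendsto' 0 u (by simp))
          (isOpen_ball.mem_nhds hur₁)
      filter_upwards [hball_ev, (self_mem_nhdsWithin : Ioi (0:ℝ) ∈ 𝓝[>] (0 : ℝ))]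
        with t hballt htpos hqQ hqim
      have htpos : 0 < t := htpos
      obtain ⟨hW', -, -, hF', hd', hs'⟩ := hΨ _ hqQ hqim
      have hcoord : (u - (σ * t) • v) 0 = -(σ * t) := by
        rw [hcoord_sub, hv0, hu00]; ring
      have hμsign : Real.sign (-μ (u - (σ * t) • v)) = σ ∧ μ (u - (σ * t) • v) ≠ 0 := by
        rcases hσ with rfl | rfl
        · have h : (u - (1 * t) • v) 0 < 0 := by rw [hcoord]; linarith
          have := hμneg _ hballt h
          exact ⟨Real.sign_of_pos (by linarith), this.ne⟩
        · have h : 0 < (u - (-1 * t) • v) 0 := by rw [hcoord]; linarith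
          have := hμpos _ hballt h
          exact ⟨Real.sign_of_neg (by linarith), this.ne'⟩
      refine ⟨⟨⟨hW', hF'.2 ⟨rfl, by simp⟩⟩, fun h => hμsign.2 ?_⟩, ?_⟩
      · simpa using hd' h.1
      · show s (Ψ ((u - (σ * t) • v, 0), -μ (u - (σ * t) • v))) = σ
        rw [hs']
        exact hμsign.1
  refine ⟨⟨hWo, fun x hx => hS_sign x ⟨⟨hx.1.1, hFH x hx.1.1 hx.1.2⟩, hFd x hx.1.2 hx.2⟩,
    fun x hx => mem_nhdsWithin_of_mem_nhds
      (hev x hx.1.1 (hFH x hx.1.1 hx.1.2) (hFd x hx.1.2 hx.2)), hF_nhds, hF_closure⟩, ?_⟩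
  /- the crossing arc through `d z₀` -/
  obtain ⟨u, ρ, ρ', hu, hu0, hΦy, hΘq₀, hρ, hρ', hρ'ρ, hballr₁, hgood, hμvar, -, -, -⟩ :=
    hlocal (d z₀) hz₀W ⟨z₀, rfl⟩ univ univ_mem
  have hμu : μ u = 0 := hδμ (d z₀) hz₀W ⟨z₀, rfl⟩ hzF u hΦy
  have hgood' : ∀ q ∈ (ball u ρ' ×ˢ Ioo (-ρ') ρ') ×ˢ Ioo (-ρ) ρ,
      q ∈ Q ∧ Θ q ∈ Ξ '' (V ∩ V') := fun q hq => ⟨(hgood q hq).1, (hgood q hq).2.1⟩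
  have hμabs : ∀ u' ∈ ball u ρ', -μ u' ∈ Ioo (-ρ) ρ := by
    intro u' hu'
    have := hμvar u' hu'
    rw [Real.dist_eq, hμu, sub_zero, abs_lt] at this
    exact ⟨by linarith, by linarith⟩
  set γ : ℝ → X := fun t => Ψ ((u + t • v, 0), -μ (u + t • v)) with hγ
  have hvnorm : ‖v‖ = 1 := by simp [hv]
  have hut : ∀ t ∈ Icc (-(ρ' / 2)) (ρ' / 2), u + t • v ∈ ball u ρ' := by
    intro t ht
    rw [mem_ball, dist_eq_norm, add_sub_cancel_left, norm_smul, hvnorm, mul_one, Real.norm_eq_abs]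
    exact lt_of_le_of_lt (abs_le.2 ⟨by linarith [ht.1], ht.2⟩) (by linarith)
  refine ⟨γ, ρ' / 2, by linarith, ?_, ?_, fun t ht => ?_⟩
  · -- continuity
    refine hΨcont.comp ?_ fun t ht => hgood' _ ⟨⟨hut t ht, by simp [hρ']⟩, hμabs _ (hut t ht)⟩
    have h1 : Continuous fun t : ℝ => u + t • v := by fun_prop
    exact (h1.continuousOn.prodMk continuousOn_const).prodMk
      ((hμc.mono hballr₁).comp h1.continuousOn fun t ht => hut t ht).neg
  · -- `γ 0 = d z₀`
    show Ψ ((u + (0:ℝ) • v, 0), -μ (u + (0:ℝ) • v)) = d z₀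
    rw [zero_smul, add_zero, hμu, neg_zero]
    show Ξ.symm (Θ ((u, 0), 0)) = d z₀
    rw [hΘq₀, hΞsymm _ hz₀W]
  · have hu' := hut t ht
    have hq : ((u + t • v, (0 : ℝ)), -μ (u + t • v)) ∈ (ball u ρ' ×ˢ Ioo (-ρ') ρ') ×ˢ Ioo (-ρ) ρ :=
      ⟨⟨hu', by simp [hρ']⟩, hμabs _ hu'⟩
    obtain ⟨hqQ, hqim⟩ := hgood' _ hq
    obtain ⟨hW', -, -, hF', hd', hs'⟩ := hΨ _ hqQ hqim
    have hu00 : u 0 = 0 := (hδ0 (d z₀) hz₀W ⟨z₀, rfl⟩ hzF u hΦy).1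
    have hcoord : (u + t • v) 0 = t := by simp [hv0, hu00]
    have hγt : γ t = Ψ ((u + t • v, 0), -μ (u + t • v)) := rfl
    rw [hγt]
    refine ⟨⟨hF'.2 ⟨rfl, by simp⟩, hW'⟩, fun ht0 => ?_⟩
    have hμsign : Real.sign (-μ (u + t • v)) = -Real.sign t ∧ μ (u + t • v) ≠ 0 := by
      rcases lt_or_gt_of_ne ht0 with h | h
      · have h' : (u + t • v) 0 < 0 := by rw [hcoord]; exact h
        have := hμneg _ (hballr₁ hu') h'
        rw [Real.sign_of_neg h, Real.sign_of_pos (by linarith)]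
        exact ⟨by norm_num, this.ne⟩
      · have h' : 0 < (u + t • v) 0 := by rw [hcoord]; exact h
        have := hμpos _ (hballr₁ hu') h'
        rw [Real.sign_of_pos h, Real.sign_of_neg (by linarith)]
        exact ⟨rfl, this.ne'⟩
    refine ⟨fun h => hμsign.2 ?_, by rw [hs', hμsign.1]⟩
    simpa using hd' h

end Literature.Topology.FourManifolds
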